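import Summits.Ventures.LatticeQCDFlow.Scaling.HubChainEigenbasis

/-!
HONEST FRAMING: exact (Metropolis-corrected) sampling algorithms for lattice gauge theory; figures
of merit are autocorrelation/cost numbers at stated couplings and volumes; no continuum-physics
claim.

# HubChainSpectralGap — THE SWAP PHASE SOLVED EXACTLY, IV: EIGEN-EXPANSION AND PARSEVAL IN `ℓ²(ρ)`, THE DIRICHLET FORM ON THE EIGENBASIS, AND THE EXACT POINCARÉ CONSTANT OF THE HUB
# CHAIN: `⟨g,Pg⟩_ρ ≤ β_{m−1}‖g‖²_ρ` ON MEAN-ZERO `g` WITH `1 − β_{m−1} = c·R_m/ρ_{m−1} ∈ [c, cm]` (ATTAINED BY `f_{m−1}`), AND `⟨g,Pg⟩_ρ ≥ β_1‖g‖²_ρ ≥ (1 − cm)‖g‖²_ρ`: THE SWAP PHASE IS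
# NEVER THE BOTTLENECK — ITS RELAXATION TAKES AT MOST `1/c = K` ATTEMPTS WHATEVER THE PERSISTENCES (lean-2 GEN-39, ours)

Venture-side (OURS).  Cell `lqcd-flow` (pub-lqcd), unit `pub-lqcd-lean-2-g39`, 2026-08-30.  Chapter Y (the swap phase solved exactly), file 4.  Setting and hypothesis-equations of
file 1 (`HubChainEigenbasis`).  For any `g` on the ranks, with `a_k = ⟨f_k,g⟩_ρ/(ρ_kR_kR_{k+1})` and `ḡ = Σ_jρ_jg_j`:

* **`hubChain_expand`**: `g(i) = ḡ/R_m + Σ_{k<m} a_kf_k(i)` (completeness of file 1 read as an expansion);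
* **`hubChain_parseval`**: `Σ_iρ_ig(i)² = ḡ²/R_m + Σ_k a_k²·ρ_kR_kR_{k+1}`;
* **`hubChain_dirichlet_eq`**: `Σ_iρ_ig(i)(Pg)(i) = ḡ²/R_m + Σ_k β_k a_k²·ρ_kR_kR_{k+1}`;
* **`hubChain_form_le`** ∕ **`hubChain_form_ge`**: for `ḡ = 0`, `β_1·Σρg² ≤ ⟨g,Pg⟩_ρ ≤ β_{m−1}·Σρg²` (so every eigenvalue on mean-zero functions lies in `[β_1, β_{m−1}] ⊂ [1−cm, 1−c]`);
* **`hubChain_gap_eq`**: `1 − β_{m−1} = c·R_m/ρ_{m−1}`, with `c ≤ c·R_m/ρ_{m−1} ≤ c·m`.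

Reading (no numerics implied): with `c = 1/K` and `m = K+1` particles, the swap phase of the tempering star has `ℓ²(ρ)`-spectral gap `(1/K)·W_min·Σ_j(1/W_j) ≥ 1/K` and all its
non-trivial eigenvalues in `[−1/K, 1 − 1/K]`: it relaxes within `K` attempts for EVERY family of persistences — persistence enters the star's laws only through the stationary law
`∝ 1/W` of the hub particle (which particle sits at the hub), never through a slow swap phase.  Literature grade (cell rule): OWN, elementary (Liu 1996 has the IMH spectrum on a finite
space; named, not cited); no new bib keys.
-/

open Finset

namespace Summit.Ventures.LatticeQCDFlow.Scaling

section HubChainGap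
variable {m : ℕ} {ρ R β : ℕ → ℝ} {c : ℝ} {P f : ℕ → ℕ → ℝ} {g a : ℕ → ℝ} {gbar : ℝ}

/-- **EXPANSION IN THE EIGENBASIS:** `g(i) = ḡ/R_m + Σ_{k<m} a_kf_k(i)` for `i < m`, where `a_k = (Σ_jρ_jf_k(j)g(j))/(ρ_kR_kR_{k+1})` and `ḡ = Σ_jρ_jg(j)`. [ours] -/
theorem hubChain_expand (hρ : ∀ i, 0 < ρ i) (hR : ∀ k, R k = ∑ i ∈ range k, ρ i)
    (hf : ∀ k i, f k i = if i < k then ρ k else if i = k then -R k else 0)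
    (ha : ∀ k, a k = (∑ j ∈ range m, ρ j * f k j * g j) / (ρ k * R k * R (k + 1))) (hgbar : gbar = ∑ j ∈ range m, ρ j * g j)
    {i : ℕ} (hi : i < m) : g i = gbar / R m + ∑ k ∈ range m, a k * f k i := by
  -- `g(i) = Σ_j δ_{ij} g(j)` with `δ_{ij}` from completeness
  have h1 : g i = ∑ j ∈ range m, (ρ j * (1 / R m + ∑ k ∈ range m, f k i * f k j / (ρ k * R k * R (k + 1)))) * g j := by
    rw [show (∑ j ∈ range m, (ρ j * (1 / R m + ∑ k ∈ range m, f k i * f k j / (ρ k * R k * R (k + 1)))) * g j)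
        = ∑ j ∈ range m, (if i = j then g j else 0) from
      sum_congr rfl fun j hj => by rw [hubChain_complete hρ hR hf hi (mem_range.mp hj)]; split_ifs <;> ring]
    rw [Finset.sum_ite_eq, if_pos (mem_range.mpr hi)]
  rw [h1, hgbar, sum_div]
  simp_rw [ha]
  rw [show (∑ k ∈ range m, (∑ j ∈ range m, ρ j * f k j * g j) / (ρ k * R k * R (k + 1)) * f k i)
      = ∑ j ∈ range m, ∑ k ∈ range m, ρ j * (f k i * f k j / (ρ k * R k * R (k + 1))) * g j by
    rw [sum_comm]; refine sum_congr rfl fun k _ => ?_; rw [sum_div, sum_mul]; exact sum_congr rfl fun j _ => by ring]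
  rw [← sum_add_distrib]
  refine sum_congr rfl fun j _ => ?_
  rw [mul_add, add_mul, mul_sum, sum_mul]
  congr 1
  ring

/-- `⟨f_k, g⟩_ρ = a_k·ρ_kR_kR_{k+1}` (the definition of `a_k`, cleared of the denominator; for the empty rank `k = 0` both sides vanish). [ours] -/
theorem hubChain_coeff (hρ : ∀ i, 0 < ρ i) (hR : ∀ k, R k = ∑ i ∈ range k, ρ i)
    (hf : ∀ k i, f k i = if i < k then ρ k else if i = k then -R k else 0)
    (ha : ∀ k, a k = (∑ j ∈ range m, ρ j * f k j * g j) / (ρ k * R k * R (k + 1))) {k : ℕ} (hk : k < m) :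
    ∑ j ∈ range m, ρ j * f k j * g j = a k * (ρ k * R k * R (k + 1)) := by
  rw [ha]
  by_cases hN : ρ k * R k * R (k + 1) = 0
  · -- then `R_k = 0`, i.e. `k = 0`, and `f_0 = 0`
    rw [hN, mul_zero]
    have hRk1 : 0 < R (k + 1) := by rw [hR (k + 1)]; exact sum_pos (fun i _ => hρ i) ⟨k, mem_range.mpr (Nat.lt_succ_self k)⟩
    have hRk : R k = 0 := by
      rcases mul_eq_zero.mp hN with h | h
      · rcases mul_eq_zero.mp h with h' | h'
        · exact absurd h' (hρ k).ne'
        · exact h'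
      · exact absurd h hRk1.ne'
    have hk0 : k = 0 := by
      by_contra hk0
      have : 0 < R k := by rw [hR k]; exact sum_pos (fun i _ => hρ i) ⟨0, mem_range.mpr (Nat.pos_of_ne_zero hk0)⟩
      linarith
    subst hk0
    refine sum_eq_zero fun j _ => ?_
    rw [hf 0 j]
    rcases Nat.eq_zero_or_pos j with hj | hj
    · subst hj; rw [if_neg (lt_irrefl 0), if_pos rfl, hRk]; ring
    · rw [if_neg (by omega), if_neg (by omega)]; ring
  · have _ := hk; rw [div_mul_cancel₀ _ hN]

/-- **PARSEVAL:** `Σ_iρ_ig(i)² = ḡ²/R_m + Σ_k a_k²·ρ_kR_kR_{k+1}`. [ours] -/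
theorem hubChain_parseval (hρ : ∀ i, 0 < ρ i) (hR : ∀ k, R k = ∑ i ∈ range k, ρ i)
    (hf : ∀ k i, f k i = if i < k then ρ k else if i = k then -R k else 0)
    (ha : ∀ k, a k = (∑ j ∈ range m, ρ j * f k j * g j) / (ρ k * R k * R (k + 1))) (hgbar : gbar = ∑ j ∈ range m, ρ j * g j) :
    ∑ i ∈ range m, ρ i * g i ^ 2 = gbar ^ 2 / R m + ∑ k ∈ range m, a k ^ 2 * (ρ k * R k * R (k + 1)) := by
  calc ∑ i ∈ range m, ρ i * g i ^ 2 = ∑ i ∈ range m, ρ i * g i * (gbar / R m + ∑ k ∈ range m, a k * f k i) :=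
        sum_congr rfl fun i hi => by rw [← hubChain_expand hρ hR hf ha hgbar (mem_range.mp hi)]; ring
    _ = (gbar / R m) * ∑ i ∈ range m, ρ i * g i + ∑ k ∈ range m, a k * ∑ i ∈ range m, ρ i * f k i * g i := by
        simp_rw [mul_add, mul_sum]
        rw [sum_add_distrib, sum_comm]
        congr 1
        · exact sum_congr rfl fun i _ => by ring
        · exact sum_congr rfl fun k _ => sum_congr rfl fun i _ => by ring
    _ = gbar ^ 2 / R m + ∑ k ∈ range m, a k ^ 2 * (ρ k * R k * R (k + 1)) := by
        rw [← hgbar]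
        congr 1
        · ring
        · exact sum_congr rfl fun k hk => by rw [hubChain_coeff hρ hR hf ha (mem_range.mp hk)]; ring

/-- **THE DIRICHLET FORM ON THE EIGENBASIS:** `Σ_iρ_ig(i)(Pg)(i) = ḡ²/R_m + Σ_k β_k a_k²·ρ_kR_kR_{k+1}`. [ours] -/
theorem hubChain_form_eq (hρ : ∀ i, 0 < ρ i) (hmono : Monotone ρ) (hR : ∀ k, R k = ∑ i ∈ range k, ρ i)
    (hPoff : ∀ i j, i ≠ j → P i j = c * min 1 (ρ j / ρ i)) (hPdiag : ∀ i, P i i = 1 - ∑ j ∈ (range m).erase i, P i j)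
    (hf : ∀ k i, f k i = if i < k then ρ k else if i = k then -R k else 0)
    (hβ : ∀ k, β k = 1 - c * (((m - k : ℕ) : ℝ) + R k / ρ k))
    (ha : ∀ k, a k = (∑ j ∈ range m, ρ j * f k j * g j) / (ρ k * R k * R (k + 1))) (hgbar : gbar = ∑ j ∈ range m, ρ j * g j) :
    ∑ i ∈ range m, ρ i * g i * ∑ j ∈ range m, P i j * g j = gbar ^ 2 / R m + ∑ k ∈ range m, β k * a k ^ 2 * (ρ k * R k * R (k + 1)) := by
  -- `(Pg)(i) = ḡ/R + Σ_k a_kβ_kf_k(i)` by the expansion and the eigen-equation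
  have hPg : ∀ i, i < m → ∑ j ∈ range m, P i j * g j = gbar / R m + ∑ k ∈ range m, a k * (β k * f k i) := by
    intro i hi
    calc ∑ j ∈ range m, P i j * g j = ∑ j ∈ range m, P i j * (gbar / R m + ∑ k ∈ range m, a k * f k j) :=
          sum_congr rfl fun j hj => by rw [← hubChain_expand hρ hR hf ha hgbar (mem_range.mp hj)]
      _ = (gbar / R m) * ∑ j ∈ range m, P i j + ∑ k ∈ range m, a k * ∑ j ∈ range m, P i j * f k j := by
          simp_rw [mul_add, mul_sum]
          rw [sum_add_distrib, sum_comm]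
          congr 1
          · exact sum_congr rfl fun j _ => by ring
          · exact sum_congr rfl fun k _ => sum_congr rfl fun j _ => by ring
      _ = gbar / R m + ∑ k ∈ range m, a k * (β k * f k i) := by
          rw [hubChain_rowsum hPdiag hi, mul_one]
          congr 1
          exact sum_congr rfl fun k hk => by rw [hubChain_eigen hρ hmono hR hPoff hPdiag hf hβ (mem_range.mp hk) hi]
  calc ∑ i ∈ range m, ρ i * g i * ∑ j ∈ range m, P i j * g j = ∑ i ∈ range m, ρ i * g i * (gbar / R m + ∑ k ∈ range m, a k * (β k * f k i)) :=
        sum_congr rfl fun i hi => by rw [hPg i (mem_range.mp hi)]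
    _ = (gbar / R m) * ∑ i ∈ range m, ρ i * g i + ∑ k ∈ range m, a k * β k * ∑ i ∈ range m, ρ i * f k i * g i := by
        simp_rw [mul_add, mul_sum]
        rw [sum_add_distrib, sum_comm]
        congr 1
        · exact sum_congr rfl fun i _ => by ring
        · exact sum_congr rfl fun k _ => sum_congr rfl fun i _ => by ring
    _ = gbar ^ 2 / R m + ∑ k ∈ range m, β k * a k ^ 2 * (ρ k * R k * R (k + 1)) := by
        rw [← hgbar]
        congr 1
        · ring
        · exact sum_congr rfl fun k hk => by rw [hubChain_coeff hρ hR hf ha (mem_range.mp hk)]; ring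

/-- **THE EXACT POINCARÉ INEQUALITY (upper):** for mean-zero `g` (`Σρg = 0`), `⟨g,Pg⟩_ρ ≤ β_{m−1}·‖g‖²_ρ` (`c ≥ 0`). [ours] -/
theorem hubChain_form_le (hρ : ∀ i, 0 < ρ i) (hmono : Monotone ρ) (hR : ∀ k, R k = ∑ i ∈ range k, ρ i)
    (hPoff : ∀ i j, i ≠ j → P i j = c * min 1 (ρ j / ρ i)) (hPdiag : ∀ i, P i i = 1 - ∑ j ∈ (range m).erase i, P i j)
    (hf : ∀ k i, f k i = if i < k then ρ k else if i = k then -R k else 0)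
    (hβ : ∀ k, β k = 1 - c * (((m - k : ℕ) : ℝ) + R k / ρ k)) (hc : 0 ≤ c)
    (hg0 : ∑ j ∈ range m, ρ j * g j = 0) :
    ∑ i ∈ range m, ρ i * g i * ∑ j ∈ range m, P i j * g j ≤ β (m - 1) * ∑ i ∈ range m, ρ i * g i ^ 2 := by
  obtain ⟨a, ha⟩ : ∃ a : ℕ → ℝ, ∀ k, a k = (∑ j ∈ range m, ρ j * f k j * g j) / (ρ k * R k * R (k + 1)) := ⟨_, fun _ => rfl⟩
  rw [hubChain_form_eq hρ hmono hR hPoff hPdiag hf hβ ha rfl, hubChain_parseval hρ hR hf ha rfl, hg0]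
  simp only [zero_pow two_ne_zero, zero_div, zero_add]
  rw [mul_sum]
  refine sum_le_sum fun k hk => ?_
  have hN : 0 ≤ a k ^ 2 * (ρ k * R k * R (k + 1)) := by
    have hRk : 0 ≤ R k := by rw [hR k]; exact sum_nonneg fun i _ => (hρ i).le
    have hRk1 : 0 ≤ R (k + 1) := by rw [hR (k + 1)]; exact sum_nonneg fun i _ => (hρ i).le
    exact mul_nonneg (sq_nonneg _) (mul_nonneg (mul_nonneg (hρ k).le hRk) hRk1)
  calc β k * a k ^ 2 * (ρ k * R k * R (k + 1)) = β k * (a k ^ 2 * (ρ k * R k * R (k + 1))) := by ring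
    _ ≤ β (m - 1) * (a k ^ 2 * (ρ k * R k * R (k + 1))) :=
        mul_le_mul_of_nonneg_right (hubChain_beta_mono hρ hmono hR hβ hc (by have := mem_range.mp hk; omega) (by have := mem_range.mp hk; omega)) hN

/-- **THE EXACT POINCARÉ INEQUALITY (lower):** for mean-zero `g`, `⟨g,Pg⟩_ρ ≥ β_1·‖g‖²_ρ` (`β_1 ≥ 1 − cm` is the bottom of the spectrum; for `m ≤ 1` both sides vanish). [ours] -/
theorem hubChain_form_ge (hρ : ∀ i, 0 < ρ i) (hmono : Monotone ρ) (hR : ∀ k, R k = ∑ i ∈ range k, ρ i)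
    (hPoff : ∀ i j, i ≠ j → P i j = c * min 1 (ρ j / ρ i)) (hPdiag : ∀ i, P i i = 1 - ∑ j ∈ (range m).erase i, P i j)
    (hf : ∀ k i, f k i = if i < k then ρ k else if i = k then -R k else 0)
    (hβ : ∀ k, β k = 1 - c * (((m - k : ℕ) : ℝ) + R k / ρ k)) (hc : 0 ≤ c)
    (hg0 : ∑ j ∈ range m, ρ j * g j = 0) :
    β 1 * ∑ i ∈ range m, ρ i * g i ^ 2 ≤ ∑ i ∈ range m, ρ i * g i * ∑ j ∈ range m, P i j * g j := by
  obtain ⟨a, ha⟩ : ∃ a : ℕ → ℝ, ∀ k, a k = (∑ j ∈ range m, ρ j * f k j * g j) / (ρ k * R k * R (k + 1)) := ⟨_, fun _ => rfl⟩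
  rw [hubChain_form_eq hρ hmono hR hPoff hPdiag hf hβ ha rfl, hubChain_parseval hρ hR hf ha rfl, hg0]
  simp only [zero_pow two_ne_zero, zero_div, zero_add]
  rw [mul_sum]
  refine sum_le_sum fun k hk => ?_
  have hRk : 0 ≤ R k := by rw [hR k]; exact sum_nonneg fun i _ => (hρ i).le
  have hRk1 : 0 ≤ R (k + 1) := by rw [hR (k + 1)]; exact sum_nonneg fun i _ => (hρ i).le
  have hN : 0 ≤ a k ^ 2 * (ρ k * R k * R (k + 1)) := mul_nonneg (sq_nonneg _) (mul_nonneg (mul_nonneg (hρ k).le hRk) hRk1)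
  rcases Nat.eq_zero_or_pos k with hk0 | hk0
  · -- rank `0`: `R_0 = 0`, the term vanishes on both sides
    subst hk0
    have : R 0 = 0 := by rw [hR 0, sum_range_zero]
    rw [this]; simp
  · calc β 1 * (a k ^ 2 * (ρ k * R k * R (k + 1))) ≤ β k * (a k ^ 2 * (ρ k * R k * R (k + 1))) :=
          mul_le_mul_of_nonneg_right (hubChain_beta_mono hρ hmono hR hβ hc hk0 (mem_range.mp hk)) hN
      _ = β k * a k ^ 2 * (ρ k * R k * R (k + 1)) := by ring

/-- **THE GAP IN CLOSED FORM:** `1 − β_{m−1} = c·R_m/ρ_{m−1}`, and `c ≤ c·R_m/ρ_{m−1} ≤ c·m` (for `m ≥ 1`, `c ≥ 0`): the swap phase relaxes within `1/c` attempts whatever the depths. [ours] -/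
theorem hubChain_gap_eq (hρ : ∀ i, 0 < ρ i) (hmono : Monotone ρ) (hR : ∀ k, R k = ∑ i ∈ range k, ρ i)
    (hβ : ∀ k, β k = 1 - c * (((m - k : ℕ) : ℝ) + R k / ρ k)) (hc : 0 ≤ c) (hm : 1 ≤ m) :
    1 - β (m - 1) = c * R m / ρ (m - 1) ∧ c ≤ c * R m / ρ (m - 1) ∧ c * R m / ρ (m - 1) ≤ c * m := by
  have hRm : R m = R (m - 1) + ρ (m - 1) := by
    rw [hR m, hR (m - 1), show m = (m - 1) + 1 from by omega, sum_range_succ, Nat.add_sub_cancel]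
  have hρm := hρ (m - 1)
  have hR0 : 0 ≤ R (m - 1) := by rw [hR (m - 1)]; exact sum_nonneg fun i _ => (hρ i).le
  have hRle : R (m - 1) ≤ (m - 1 : ℕ) * ρ (m - 1) := by
    rw [hR (m - 1)]
    calc ∑ i ∈ range (m - 1), ρ i ≤ ∑ i ∈ range (m - 1), ρ (m - 1) := sum_le_sum fun i hi => hmono (mem_range.mp hi).le
      _ = (m - 1 : ℕ) * ρ (m - 1) := by rw [sum_const, card_range, nsmul_eq_mul]
  refine ⟨?_, ?_, ?_⟩
  · rw [hβ (m - 1), show m - (m - 1) = 1 by omega, hRm]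
    push_cast
    field_simp
    ring
  · rw [le_div_iff₀ hρm, hRm]; nlinarith
  · rw [div_le_iff₀ hρm, hRm]
    have : ((m - 1 : ℕ) : ℝ) = (m : ℝ) - 1 := by rw [Nat.cast_sub hm]; simp
    rw [this] at hRle
    nlinarith

end HubChainGap

end Summit.Ventures.LatticeQCDFlow.Scaling
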